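import Summits.KontsevichZagierPeriods.KontsevichZagierPeriods.Theorems.RootDecompRationalCubeDichotomyPiRationalisationEtale

/-!
# Route RootDecompRationalCubeDichotomy — items 29429 `PiRationalisationEtale` / 29431 `PiRationalisationGlue` PROVED, part 8/8: ROUTE ITEM 29431 `PiRationalisationGlue` PROVED BY NAME (`piRationalisationGlue_proof`, via `piIter_sum`) and the node consequence `piRationalisation_of_nashEtaleCover : NashEtaleCover → PiRationalisation` (crux 24903 ⟸ item 29430 alone) (`RootDecompRationalCubeDichotomyPiRationalisationGlue`)

Theorems-split (≤ 400 lines each, sequential imports) of the decomp-kz lens-2 gen-5 file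
`run/shared/lean/pub/decomp-kz/decomp-kz-lens-2/g5/PiRationalisationEtale.lean` (sha256 204f4992…, 2557 lines; lens farm rc 0 / 0 sorry /
std axioms; critic decomp-kz-crit-1 g2 CLEARED/CONFIRMED 2026-08-30T06:50:50Z «29429 + 29431 proved BY NAME»), landed by the census seat
decomp-kz-census-1 g6 with the 86 verbatim copies of already-landed declarations REMOVED in favour of `import`/`open` of the landed
`Rung27842.ReIm` / `Rung27842.SimpleBranch` / `Rung24903` chain (`ratCubeSet`, `piIter_mem_sup`, `RatBoxSet`, `BoxRescale`, `boxRescale_holds`,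
the Re–Im polynomial calculus, the Green assembly kit, the S3/S1 lemmas), so that only the NEW weighted (étale) content is declared here.
The rung: for WEIGHTED simple-branch (standard-étale) data `[Π[loᵢ,hiᵢ], A(x,h x)/B(x,h x)]` (`F(x,h) = 0`, `∂_w F(x,h) ≠ 0`, `B(x,h) ≠ 0` on the
closed box, `F A B ∈ ℚ[x,w]`, `h` ℚ-Nash near the box) `[π]^K·[s] ∈ relations ⊔ ⟨rational closed-cube sector⟩` for every `K ≥ 1` — the gen-4
argument-principle chain with the contour form `ω = A·F_w/(B·F) dw`, whose residue at the simple real root is `A/B = s.integrand`.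
[Kontsevich–Zagier 2001 §1.2; argument principle] Standard axioms, 0 sorry.
-/

noncomputable section

set_option linter.dupNamespace false

namespace Summit.KontsevichZagierPeriods.RootDecompRationalCubeDichotomy.RungEtale.Etale

open MeasureTheory Set MvPolynomial
open Literature.NumberTheory.Transcendental Literature.NumberTheory.Transcendental.KZ
open Literature.ModelTheory.ExponentialFields (IsSemialgebraic analyticOnNhd_aeval continuous_aeval_real)
open Summit.KontsevichZagierPeriods.KontsevichZagierPeriods.Theses.RootDecompRationalCubeDichotomy
open Summit.KontsevichZagierPeriods.RootDecompRationalCubeDichotomy.Rung24903 (of_sub_of_mem_relations_of_fibreMap)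
open Summit.KontsevichZagierPeriods.RootDecompRationalCubeDichotomy.Rung27842
open Summit.KontsevichZagierPeriods.RootDecompRationalCubeDichotomy.Rung27842.RootIso
open Summit.KontsevichZagierPeriods.RootDecompRationalCubeDichotomy.Rung27842.SimpleBranch
open Summit.KontsevichZagierPeriods.RootDecompRationalCubeDichotomy.Rung24903
  (piRep_mul_mem_sup_of_mem_closure piRep_mul_mem_sup piIter_mem_sup isSemialgebraic_cubeLit)

/-- The `[π]·`-iterate commutes with finite sums. -/
theorem piIter_sum {ι : Type*} (T : Finset ι) (K : ℕ) (f : ι → FormalRep) :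
    (fun y : FormalRep => of piRep * y)^[K] (∑ i ∈ T, f i) =
      ∑ i ∈ T, (fun y : FormalRep => of piRep * y)^[K] (f i) := by
  let φ : FormalRep →+ FormalRep := AddMonoidHom.mk' _ (piIter_add K)
  show φ (∑ i ∈ T, f i) = ∑ i ∈ T, φ (f i)
  exact map_sum φ f T

/-- **Item stmt-KontsevichZagierPeriods-29431 `PiRationalisationGlue` HOLDS** (route decl BY NAME =
`PiRationalisationEtale → NashEtaleCover → PiRationalisation`; the proof of `g5/EtaleResolution.lean` re-pointed at the
born decls): grid the cube by the étale cover (domain additivity, null overlaps), treat every box by the étale piece,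
`K₀ = max`. -/
theorem piRationalisationGlue_proof : Summit.KontsevichZagierPeriods.KontsevichZagierPeriods.Theses.RootDecompRationalCubeDichotomy.PiRationalisationGlue := by
  intro hE hC n g U s hU hcU hsa hga hsd hsg
  obtain ⟨N, hN0, hcov⟩ := hC n g U hU hcU hsa hga
  choose V h F A B hV hbV hhs hha hloc using hcov
  have hNpos : (0:ℝ) < N := by exact_mod_cast hN0
  -- the grid of `Nⁿ` rational boxes
  let lo : (Fin n → Fin N) → Fin n → ℚ := fun κ i => ((κ i : ℕ) : ℚ) / N
  let hi : (Fin n → Fin N) → Fin n → ℚ := fun κ i => (((κ i : ℕ) : ℚ) + 1) / N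
  let box : (Fin n → Fin N) → Set (Fin n → ℝ) := fun κ =>
    Set.pi Set.univ (fun i : Fin n => Icc ((lo κ i : ℚ) : ℝ) (hi κ i))
  have hlo : ∀ κ i, ((lo κ i : ℚ) : ℝ) = ((κ i : ℕ) : ℝ) / (N : ℝ) := by intro κ i; simp [lo]
  have hhi : ∀ κ i, ((hi κ i : ℚ) : ℝ) = (((κ i : ℕ) : ℝ) + 1) / (N : ℝ) := by intro κ i; simp [hi]
  have hlohi : ∀ κ i, lo κ i < hi κ i := by
    intro κ i
    exact div_lt_div_of_pos_right (by linarith) (by exact_mod_cast hN0)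
  have hboxeq : ∀ κ, box κ =
      Set.pi Set.univ (fun i : Fin n => Set.Icc (((κ i : ℕ) : ℝ) / N) ((((κ i : ℕ) : ℝ) + 1) / N)) := by
    intro κ
    simp only [box, hlo, hhi]
  have hbox_cube : ∀ κ, box κ ⊆ Set.pi Set.univ (fun _ : Fin n => Set.Icc (0:ℝ) 1) := by
    intro κ x hx
    rw [Set.mem_univ_pi] at hx ⊢
    intro i
    have hxi := hx i
    rw [Set.mem_Icc, hlo, hhi] at hxi
    refine ⟨le_trans (by positivity) hxi.1, le_trans hxi.2 ?_⟩
    rw [div_le_one hNpos]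
    have h := (κ i).isLt
    exact_mod_cast Nat.succ_le_of_lt h
  -- every point of the cube lies in a grid box
  have hcover : ∀ x ∈ Set.pi Set.univ (fun _ : Fin n => Set.Icc (0:ℝ) 1), ∃ κ, x ∈ box κ := by
    intro x hx
    rw [Set.mem_univ_pi] at hx
    refine ⟨fun i => ⟨min ⌊(N:ℝ) * x i⌋₊ (N - 1), by omega⟩, ?_⟩
    rw [Set.mem_univ_pi]
    intro i
    have hx0 : 0 ≤ x i := (hx i).1
    have hx1 : x i ≤ 1 := (hx i).2
    have hfl : (⌊(N:ℝ) * x i⌋₊ : ℝ) ≤ N * x i := Nat.floor_le (by positivity)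
    have hfl' : (N:ℝ) * x i < ⌊(N:ℝ) * x i⌋₊ + 1 := Nat.lt_floor_add_one _
    have hcomm : x i * (N:ℝ) = N * x i := mul_comm _ _
    simp only [Set.mem_Icc, hlo, hhi]
    constructor
    · rw [div_le_iff₀ hNpos]
      have hmin : ((min ⌊(N:ℝ) * x i⌋₊ (N - 1) : ℕ) : ℝ) ≤ ⌊(N:ℝ) * x i⌋₊ := by
        exact_mod_cast min_le_left _ _
      linarith
    · rw [le_div_iff₀ hNpos]
      by_cases hc : ⌊(N:ℝ) * x i⌋₊ ≤ N - 1
      · have hmin : ((min ⌊(N:ℝ) * x i⌋₊ (N - 1) : ℕ) : ℝ) = ⌊(N:ℝ) * x i⌋₊ := by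
          rw [min_eq_left hc]
        rw [hmin]
        linarith
      · push Not at hc
        have hmin : ((min ⌊(N:ℝ) * x i⌋₊ (N - 1) : ℕ) : ℝ) + 1 = N := by
          rw [min_eq_right hc.le, Nat.cast_sub (by omega), Nat.cast_one]; ring
        rw [hmin]
        nlinarith
  -- distinct grid boxes meet in a null set
  have hnull : ∀ κ κ', κ ≠ κ' → volume (box κ ∩ box κ') = 0 := by
    intro κ κ' hne
    obtain ⟨i, hi_ne⟩ := Function.ne_iff.1 hne
    have hset : box κ ∩ box κ' = Set.Icc (fun j => max ((lo κ j : ℚ) : ℝ) ((lo κ' j : ℚ) : ℝ))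
        (fun j => min ((hi κ j : ℚ) : ℝ) ((hi κ' j : ℚ) : ℝ)) := by
      ext x
      simp only [box, Set.mem_inter_iff, Set.mem_univ_pi, Set.mem_Icc, Pi.le_def, max_le_iff, le_min_iff]
      constructor
      · rintro ⟨h1, h2⟩; exact ⟨fun j => ⟨(h1 j).1, (h2 j).1⟩, fun j => ⟨(h1 j).2, (h2 j).2⟩⟩
      · rintro ⟨h1, h2⟩; exact ⟨fun j => ⟨(h1 j).1, (h2 j).1⟩, fun j => ⟨(h1 j).2, (h2 j).2⟩⟩
    rw [hset, Real.volume_Icc_pi]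
    refine Finset.prod_eq_zero (Finset.mem_univ i) ?_
    rw [ENNReal.ofReal_eq_zero]
    simp only [hlo, hhi]
    have hi_ne' : (κ i : ℕ) ≠ (κ' i : ℕ) := fun h => hi_ne (Fin.ext h)
    rcases Nat.lt_or_gt_of_ne hi_ne' with h | h
    · have h1 : ((κ i : ℕ) : ℝ) + 1 ≤ (κ' i : ℕ) := by exact_mod_cast h
      have h2 : (((κ i : ℕ) : ℝ) + 1) / N ≤ ((κ' i : ℕ) : ℝ) / N := div_le_div_of_nonneg_right h1 hNpos.le
      linarith [min_le_left ((((κ i : ℕ) : ℝ) + 1) / N) ((((κ' i : ℕ) : ℝ) + 1) / N),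
        le_max_right (((κ i : ℕ) : ℝ) / N) (((κ' i : ℕ) : ℝ) / N)]
    · have h1 : ((κ' i : ℕ) : ℝ) + 1 ≤ (κ i : ℕ) := by exact_mod_cast h
      have h2 : (((κ' i : ℕ) : ℝ) + 1) / N ≤ ((κ i : ℕ) : ℝ) / N := div_le_div_of_nonneg_right h1 hNpos.le
      linarith [min_le_right ((((κ i : ℕ) : ℝ) + 1) / N) ((((κ' i : ℕ) : ℝ) + 1) / N),
        le_max_left (((κ i : ℕ) : ℝ) / N) (((κ' i : ℕ) : ℝ) / N)]
  -- the pieces: restrictions of `s` to the grid boxes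
  have hbox_dom : ∀ κ, box κ ⊆ s.domain := fun κ => by rw [hsd]; exact hbox_cube κ
  let piece : (Fin n → Fin N) → IntegralRep n := fun κ =>
    s.restrict (box κ) (isSemialgebraic_ratBox (lo κ) (hi κ)) (hbox_dom κ)
  have hsum : of s - ∑ κ, of (piece κ) ∈ relations := by
    refine of_sub_sum_of_mem_relations (Finset.univ : Finset (Fin n → Fin N)) s piece ?_ ?_ ?_ ?_
    · intro κ _
      rw [Set.sdiff_eq_empty.2 (show (piece κ).domain ⊆ s.domain from hbox_dom κ), measure_empty]
    · intro κ _ z _; rfl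
    · rw [Set.sdiff_eq_empty.2 ?_, measure_empty]
      intro x hx
      rw [hsd] at hx
      obtain ⟨κ, hκ⟩ := hcover x hx
      exact Set.mem_iUnion₂.2 ⟨κ, Finset.mem_univ κ, hκ⟩
    · intro κ _ κ' _ hne
      exact hnull κ κ' hne
  -- every box is treated by `PiRationalisationEtale`
  have hK : ∀ κ, ∃ K₀ : ℕ, ∀ K : ℕ, K₀ ≤ K →
      (fun x : FormalRep => of piRep * x)^[K] (of (piece κ)) ∈ relations ⊔ AddSubgroup.closure
        {x : FormalRep | ∃ (m : ℕ) (q : IntegralRep m) (P Q : MvPolynomial (Fin m) ℚ),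
          q.domain = Set.pi Set.univ (fun _ : Fin m => Set.Icc (0:ℝ) 1) ∧
          (∀ z ∈ Set.pi Set.univ (fun _ : Fin m => Set.Icc (0:ℝ) 1), MvPolynomial.aeval z Q ≠ 0) ∧
          (∀ z ∈ Set.pi Set.univ (fun _ : Fin m => Set.Icc (0:ℝ) 1),
            q.integrand z = MvPolynomial.aeval z P / MvPolynomial.aeval z Q) ∧ x = of q} := by
    intro κ
    have hdomκ : (piece κ).domain = box κ := rfl
    have hbV' : (piece κ).domain ⊆ V κ := by rw [hdomκ, hboxeq]; exact hbV κ
    have hmem : ∀ {x}, x ∈ (piece κ).domain →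
        x ∈ Set.pi Set.univ (fun i : Fin n => Set.Icc (((κ i : ℕ) : ℝ) / N) ((((κ i : ℕ) : ℝ) + 1) / N)) := by
      intro x hx; rw [hdomκ, hboxeq] at hx; exact hx
    refine hE n (h κ) (V κ) (piece κ) (F κ) (A κ) (B κ) (lo κ) (hi κ) (hV κ) (hlohi κ) rfl hbV' (hhs κ) (hha κ)
      ?_ ?_ ?_ ?_
    · intro x hx; exact (hloc κ x (hmem hx)).1
    · intro x hx; exact (hloc κ x (hmem hx)).2.1
    · intro x hx; exact (hloc κ x (hmem hx)).2.2.1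
    · intro x hx
      have hx' : x ∈ Set.pi Set.univ (fun _ : Fin n => Set.Icc (0:ℝ) 1) := hbox_cube κ (hdomκ ▸ hx)
      show s.integrand x = _
      rw [hsg x hx', (hloc κ x (hmem hx)).2.2.2]
  choose K₀ hK₀ using hK
  refine ⟨Finset.univ.sup K₀, fun K hKle => ?_⟩
  have hsplit : of s = (of s - ∑ κ, of (piece κ)) + ∑ κ, of (piece κ) := by abel
  rw [hsplit, piIter_add, piIter_sum]
  refine add_mem (AddSubgroup.mem_sup_left (piRep_mul_iterate_mem_relations _ hsum)) ?_
  refine AddSubgroup.sum_mem _ fun κ _ => ?_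
  exact hK₀ κ K (le_trans (Finset.le_sup (Finset.mem_univ κ)) hKle)

/-- **THE NODE CONSEQUENCE (gen 5): crux 24903 `PiRationalisation` ⟸ item 29430 `NashEtaleCover` ALONE** — a theorem
in print (étale presentation of Nash germs: BCR 1998 §8.1 / Artin–Mazur; EGA IV 18.4.6, Stacks 00UE), Lean-XL. -/
theorem piRationalisation_of_nashEtaleCover (hC : Summit.KontsevichZagierPeriods.KontsevichZagierPeriods.Theses.RootDecompRationalCubeDichotomy.NashEtaleCover) :
    Summit.KontsevichZagierPeriods.KontsevichZagierPeriods.Theses.RootDecompRationalCubeDichotomy.PiRationalisation :=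
  piRationalisationGlue_proof piRationalisationEtale_proof hC

end Summit.KontsevichZagierPeriods.RootDecompRationalCubeDichotomy.RungEtale.Etale
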